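import Summits.QuantumFields.BalabanUV.Beta.GAN24.ExitFaceRightFamily
import Summits.QuantumFields.BalabanUV.Beta.GAN24.EEWordValue

/-!
# `BalabanUV.Beta.GAN24.ExchangeLatticeWordSlot` — binder row G-an2-4 ∕ (CONV-C), W-slot (α-0), ROW (C) AT LEVELS `j ≥ 1`, the (γ) hand's memo
# `HOME/b2b-balaban-gan24-formalise-leaf-06/g52/C-LEVELS-GE1.md` §17 ∕ §19 and `g54/C-LEVELS-GE1-g54.md` §27: **THE LITERAL TWO-FACE EE LATTICE WORD OF A GENERIC LOCAL STENCIL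
# FAMILY `S` WITHOUT FIELD–MULTIPLIER BLOCKS, RESUMMED OVER ITS SECOND BOND** — decay data at one rate, joint `(bond, leg)` summability of the exit-face-read right half-vertex,
# and the `HasSum` over the second bond (`V_{κ,v} = vertexOfK X̃♮_j Lc (unitS s_f s_m S) κ v`, `X̃♮_j = unitK s_f s_m (coDressKBmAt ρ Lc (KInvStep Lc j))`; every `j`, in-block root,
# all units, ALL axis patterns) — the generic-table twin of leaf-04's `ExchangeFieldLegs` §1∕§4 and `ExchangeSlotLiteral`
# (G-an2-4 CRUX TEAM (2), seat `b2b-balaban-gan24-formalise-leaf-06` = the (γ) hand, gen 54; journal INTENT I-leaf06-g54-1)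

NOT IN PRINT; OUR BOOKKEEPING ([folklore] `tsum` ∕ Fubini bookkeeping BY NAME; 0 `def`, 0 cited fact, 0 `def … : Prop`, 0 sorry).
HONEST FRAMING (cell contract, verbatim): «discharging `BetaPertH` makes Bałaban's UV stability UNCONDITIONAL — a real constructive-QFT result; it is NOT the continuum
limit and NOT the Clay problem.»  HONEST DEPENDENCY (verbatim): «continuum YM on T⁴ ⇐ BetaPertH ∧ nine spine estimates (0/9 proved); BetaPertH ⇐ (D1) ∧ (D4) ∧ CAP+tail;
G-an2-4 gates asym, D1 and NE2/3/4.»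

WHY.  leaf-04 g69's `DressedSourceZeroModeSucc.zmode_dressedSource_succ_inl_inl` (33_j, staged) reduces the ff zero mode of the dressed level-`(j+1)` source, at every level and on
every axis pattern, to `c·κ·(EE_direct + EE_swap)` — the two LITERAL two-face lattice words of the E-sector table, in the `comp (comp V X̃) V` currency with the pair sum
`Σ'_{(y,w)}`.  This lineage's exchange chain (`ExchangeWordCellPairing.exchangeWord_eq_cellPairing` → `ExchangeESectorValue.exchangeWord_sector_value` →
`ExchangeESectorPattern`) starts from the REDUCED word (leaf-04's `EEWordReduced.ee_word_reduced` left side at level `j`).  The passage literal → reduced was typed by leaf-04 for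
the WILSON table only (`EEWordValue.ee_word_outer_fubini` ∕ `EEWordSwap.ee_word_outer_fubini'` over `ExchangeSlotLiteral` ∕ `ExchangeFieldLegs`); this file and
`ExchangeLatticeWordReduced` are its generic-table twin, so that the level-`(j+1)` E-sector words meet the chain (`ExchangeESectorLatticeWords`) and road-P2's pair-form socket
(`CombChargeAntisymPairForm.exists_pairForm_of_word`).
* §1 (algebra, no summability) **`vertexOfK_inl_inr_of_ff` ∕ `vertexOfK_inr_inl_of_ff` ∕ `comp_comp_vertex_inl_inl_of_ff`** — a table without field–multiplier blocks gives a
  chain-rule vertex without them, so the double composition read at `(inl α, inl β)` only sees ff blocks (leaf-04's `ExchangeFieldLegs.comp_comp_inl_inl`).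
* §2 **`exists_decay_data_of`** (ONE rate: the vertex family, the bi-localised left factor `V_{μ,u} ∘ X̃♮_j`, the decaying step), **`summable_prod_rightHalfVertex`** ∕
  **`tsum_prod_rightHalfVertex`** (joint `(u′, w)` summability of the exit-face-read right half-vertex; twin of `ExchangeFieldLegs.summable_prod_faceHalfVertex`).
* §3 **`tsum_integrand_eq_of`**, **`hasSum_literal_slot_of`** — twins of `ExchangeSlotLiteral.tsum_integrand_eq ∕ hasSum_literal_slot` (engines `ExchangeSlotFubini.summable_slot_family ∕
  hasSum_slot_resum`).
Asserts NO value of Bałaban's tables; discharges NOTHING of (C) ∕ (C)sym ∕ (Q-L) ∕ «T2Shape» ∕ «T2Drift» ∕ (hW, hWall); NEVER «G-an2-4 closed» as (CONV-C); NOT D1, NOT `BetaPertH`,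
NOT continuum, NOT Clay.  2026-08-24; no existing file touched.
-/

noncomputable section

open Finset
open scoped BigOperators
open Literature.MathematicalPhysics.QuantumFieldTheory
open Literature.MathematicalPhysics.QuantumFieldTheory.Balaban1983to89
open Literature.MathematicalPhysics.QuantumFieldTheory.Balaban1983to89.Beta
open B12Sec2to5 (l1 l1_nonneg)
open ExpKernelCalculus (Site MKer comp shiftK Decays BiLoc VertexFamily Zl summable_exp_shift summable_exp_shift' tsum_exp_shift')
open OneStepResolventKernel (Fib wsum LocStencil decays_mono biLoc_mono)
open BalabanStepJetsSucc (biLoc_comp_right)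
open OneStepKernelFamily (KInvStep vertexOfK vertexOfK_translate vertexFamily_vertexOfK decays_KInvStep)
open AffineAveraging (box toSite)
open Summit.QuantumFields.BalabanUV.Beta.AxialDressingRooted (coDressKBmAt decays_coDressKBmAt)
open Summit.QuantumFields.BalabanUV.Beta.HessKerDressedUnits (unitK unitS unitS_apply decays_unitK locStencil_unitS)
open Summit.QuantumFields.BalabanUV.Beta.GAN24.ResolventLegCharges (summable_exp_coarse')
open Summit.QuantumFields.BalabanUV.Beta.GAN24.EEWordReduced (shiftK_dressedStep)
open Summit.QuantumFields.BalabanUV.Beta.GAN24.ExchangeFieldLegs (comp_comp_inl_inl)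
open Summit.QuantumFields.BalabanUV.Beta.GAN24.ExchangeSlotFubini (summable_slot_family hasSum_slot_resum)

namespace Summit.QuantumFields.BalabanUV.Beta.GAN24.ExchangeLatticeWordSlot

variable {d : ℕ}

/-! ## §1 A table without field–multiplier blocks: the vertex and the double composition on field legs -/

section Algebra

variable {S : Fin (d + 1) → (Fin (d + 1) → ℤ) → MKer (d + 1) (Fib d)}

/-- [folklore] `vertexOfK X N (unitS s_f s_m S) κ u y z (inl a) (inr m) = 0` when the table has no `(inl, inr)` block. -/
theorem vertexOfK_inl_inr_of_ff (hS01 : ∀ (κ : Fin (d + 1)) (v y z : Site (d + 1)) (a m : Fin (d + 1)), S κ v y z (Sum.inl a) (Sum.inr m) = 0)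
    (X : MKer (d + 1) (Fib d)) (N : ℕ) (sf sm : ℝ) (κ : Fin (d + 1)) (u y z : Site (d + 1)) (a m : Fin (d + 1)) :
    vertexOfK X N (unitS sf sm S) κ u y z (Sum.inl a) (Sum.inr m) = 0 := by
  simp only [vertexOfK, wsum, unitS_apply, hS01, mul_zero, zero_mul, tsum_zero, Finset.sum_const_zero]

/-- [folklore] `vertexOfK X N (unitS s_f s_m S) κ u y z (inr m) (inl b) = 0` when the table has no `(inr, inl)` block. -/
theorem vertexOfK_inr_inl_of_ff (hS10 : ∀ (κ : Fin (d + 1)) (v y z : Site (d + 1)) (m b : Fin (d + 1)), S κ v y z (Sum.inr m) (Sum.inl b) = 0)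
    (X : MKer (d + 1) (Fib d)) (N : ℕ) (sf sm : ℝ) (κ : Fin (d + 1)) (u y z : Site (d + 1)) (m b : Fin (d + 1)) :
    vertexOfK X N (unitS sf sm S) κ u y z (Sum.inr m) (Sum.inl b) = 0 := by
  simp only [vertexOfK, wsum, unitS_apply, hS10, mul_zero, zero_mul, tsum_zero, Finset.sum_const_zero]

/-- [folklore] **THE LITERAL EE INTEGRAND ON FIELD LEGS** for a table without field–multiplier blocks (any middle kernel `X`, any `N`, all units, any bonds):
`((V_{μ,u} ∘ X) ∘ V_{ν,u′}) y w (inl α)(inl β) = Σ'_z Σ_b (Σ'_{y₁} Σ_a V_{μ,u} y y₁ (inl α)(inl a)·X y₁ z (inl a)(inl b))·V_{ν,u′} z w (inl b)(inl β)`. -/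
theorem comp_comp_vertex_inl_inl_of_ff
    (hS01 : ∀ (κ : Fin (d + 1)) (v y z : Site (d + 1)) (a m : Fin (d + 1)), S κ v y z (Sum.inl a) (Sum.inr m) = 0)
    (hS10 : ∀ (κ : Fin (d + 1)) (v y z : Site (d + 1)) (m b : Fin (d + 1)), S κ v y z (Sum.inr m) (Sum.inl b) = 0)
    (X' X : MKer (d + 1) (Fib d)) (N : ℕ) (sf sm : ℝ) (μ ν : Fin (d + 1)) (u u' y w : Site (d + 1)) (α β : Fin (d + 1)) :
    comp (comp (vertexOfK X' N (unitS sf sm S) μ u) X) (vertexOfK X' N (unitS sf sm S) ν u') y w (Sum.inl α) (Sum.inl β) =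
      ∑' z : Site (d + 1), ∑ b : Fin (d + 1),
        (∑' y₁ : Site (d + 1), ∑ a : Fin (d + 1), vertexOfK X' N (unitS sf sm S) μ u y y₁ (Sum.inl α) (Sum.inl a) * X y₁ z (Sum.inl a) (Sum.inl b)) *
        vertexOfK X' N (unitS sf sm S) ν u' z w (Sum.inl b) (Sum.inl β) :=
  comp_comp_inl_inl (fun y z a m => vertexOfK_inl_inr_of_ff hS01 X' N sf sm μ u y z a m) (fun y z m b => vertexOfK_inr_inl_of_ff hS10 X' N sf sm ν u' y z m b) y w α β

end Algebra

/-! ## §2 Decay data at one rate; joint summability of the exit-face-read right half-vertex -/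

section Decay

variable {Lc : ℕ} [NeZero Lc] {r : Fin (d + 1) → ℕ} {S : Fin (d + 1) → (Fin (d + 1) → ℤ) → MKer (d + 1) (Fib d)}

/-- [folklore] **DECAY DATA OF THE DRESSED VERTEX OVER A LOCAL STENCIL FAMILY** (in-block root, `1 ≤ Lc`, level `j`, all units): ONE rate `δ > 0` with the chain-rule vertex a
`VertexFamily` at rate `δ`, the left factor `V_{μ,u} ∘ X̃♮_j` bi-localised at `(Lc•u, Lc•u)` at rate `δ`, and the step kernel decaying at rate `δ`
(`decays_coDressKBmAt` ⨾ `decays_unitK` ⨾ `locStencil_unitS` ⨾ `vertexFamily_vertexOfK` ⨾ `biLoc_comp_right`; rates matched by `min` and halving). -/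
theorem exists_decay_data_of (hLc : 1 ≤ Lc) (hr : r ∈ box (d + 1) Lc) {Cs δs : ℝ} (hS : LocStencil S Cs δs) (hδs : 0 < δs) (sf sm : ℝ) (j : ℕ)
    (μ : Fin (d + 1)) (u : Site (d + 1)) :
    ∃ δ Cv C2 CX : ℝ, 0 < δ ∧ 0 ≤ Cv ∧ 0 ≤ C2 ∧ 0 ≤ CX ∧
      VertexFamily (vertexOfK (unitK sf sm (coDressKBmAt (toSite r) Lc (KInvStep (d := d) Lc j))) Lc (unitS sf sm S)) Lc Cv δ ∧
      BiLoc (comp (vertexOfK (unitK sf sm (coDressKBmAt (toSite r) Lc (KInvStep (d := d) Lc j))) Lc (unitS sf sm S) μ u)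
        (unitK sf sm (coDressKBmAt (toSite r) Lc (KInvStep (d := d) Lc j)))) ((Lc : ℤ) • u) ((Lc : ℤ) • u) C2 δ ∧
      Decays (unitK sf sm (coDressKBmAt (toSite r) Lc (KInvStep (d := d) Lc j))) CX δ := by
  obtain ⟨δK, CK, hδK, hCK, hXd⟩ := decays_coDressKBmAt hLc hr (decays_KInvStep (d := d) (Lc := Lc) j)
  have hXu := decays_unitK (sf := sf) (sm := sm) hXd
  have hSu := locStencil_unitS (sf := sf) (sm := sm) hS
  have hC : 0 ≤ max |sf| |sm| * CK * max |sf| |sm| := by positivity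
  have hCs' : 0 ≤ |(sf * sm)⁻¹| * (max |sf⁻¹| |sm⁻¹| * Cs * max |sf⁻¹| |sm⁻¹|) := by
    have : 0 ≤ Cs := (hS 0 0).nonneg (Sum.inl 0)
    positivity
  have hm0 : 0 < min δK δs := lt_min hδK hδs
  have hSm : LocStencil (unitS sf sm S) (|(sf * sm)⁻¹| * (max |sf⁻¹| |sm⁻¹| * Cs * max |sf⁻¹| |sm⁻¹|)) (min δK δs) :=
    BalabanStepJets.locStencil_mono hSu hCs' (min_le_right _ _)
  obtain ⟨Cv, hVF⟩ : ∃ Cv : ℝ, VertexFamily (vertexOfK (unitK sf sm (coDressKBmAt (toSite r) Lc (KInvStep (d := d) Lc j))) Lc (unitS sf sm S)) Lc Cv (min δK δs / 2) :=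
    ⟨_, vertexFamily_vertexOfK (N := Lc) hXu hC hSm hm0 (min_le_left _ _)⟩
  have hCv : 0 ≤ Cv := (hVF μ 0).nonneg (Sum.inl 0)
  have hXu' : Decays (unitK sf sm (coDressKBmAt (toSite r) Lc (KInvStep (d := d) Lc j))) (max |sf| |sm| * CK * max |sf| |sm|) (min δK δs / 2) :=
    decays_mono hXu hC le_rfl (by linarith [min_le_left δK δs])
  obtain ⟨C2, hVX⟩ : ∃ C2 : ℝ, BiLoc (comp (vertexOfK (unitK sf sm (coDressKBmAt (toSite r) Lc (KInvStep (d := d) Lc j))) Lc (unitS sf sm S) μ u)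
      (unitK sf sm (coDressKBmAt (toSite r) Lc (KInvStep (d := d) Lc j)))) ((Lc : ℤ) • u) ((Lc : ℤ) • u) C2 (min δK δs / 4) :=
    ⟨_, biLoc_comp_right (hVF μ u) hXu' (by positivity) (by linarith)⟩
  have hC2 : 0 ≤ C2 := hVX.nonneg (Sum.inl 0)
  exact ⟨min δK δs / 4, Cv, C2, _, by positivity, hCv, hC2, hC, fun κ v => biLoc_mono (hVF κ v) hCv (by linarith),
    hVX, decays_mono hXu hC le_rfl (by linarith [min_le_left δK δs])⟩

variable {ν β : Fin (d + 1)}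

/-- [folklore] **JOINT SUMMABILITY OVER (BOND, LEG)** of the exit-face-read right half-vertex `(u′, w) ↦ χ_β(w)·V_{ν,u′} z w (inl b)(inl β)` over a local stencil family
(majorant `C_v·e^{−δ|z − Lc u′|}·e^{−δ|w − Lc u′|}`; twin of `ExchangeFieldLegs.summable_prod_faceHalfVertex`). -/
theorem summable_prod_rightHalfVertex (hLc : 1 ≤ Lc) (hr : r ∈ box (d + 1) Lc) {Cs δs : ℝ} (hS : LocStencil S Cs δs) (hδs : 0 < δs) (sf sm : ℝ) (j : ℕ)
    (z : Site (d + 1)) (b : Fin (d + 1)) :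
    Summable fun uw : Site (d + 1) × Site (d + 1) => (if uw.2 β % (Lc : ℤ) = (Lc : ℤ) - 1 then (1 : ℝ) else 0) *
      vertexOfK (unitK sf sm (coDressKBmAt (toSite r) Lc (KInvStep (d := d) Lc j))) Lc (unitS sf sm S) ν uw.1 z uw.2 (Sum.inl b) (Sum.inl β) := by
  obtain ⟨δ, Cv, C2, CX, hδ, hCv0, -, -, hVF, -, -⟩ := exists_decay_data_of hLc hr hS hδs sf sm j ν 0
  set V := vertexOfK (unitK sf sm (coDressKBmAt (toSite r) Lc (KInvStep (d := d) Lc j))) Lc (unitS sf sm S) with hVdef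
  set M : Site (d + 1) × Site (d + 1) → ℝ := fun uw =>
    Cv * Real.exp (-δ * l1 (z - (Lc : ℤ) • uw.1)) * Real.exp (-δ * l1 (uw.2 - (Lc : ℤ) • uw.1)) with hM
  have hM0 : 0 ≤ M := fun uw => by positivity
  have hMs : Summable M := by
    refine (summable_prod_of_nonneg hM0).2 ⟨fun u' => ?_, ?_⟩
    · exact (summable_exp_shift' hδ ((Lc : ℤ) • u')).mul_left (Cv * Real.exp (-δ * l1 (z - (Lc : ℤ) • u')))
    · have e : ∀ u' : Site (d + 1), ∑' w : Site (d + 1), M (u', w) = Cv * Real.exp (-δ * l1 (z - (Lc : ℤ) • u')) * Zl (d + 1) δ := by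
        intro u'
        simp only [hM]
        rw [tsum_mul_left, tsum_exp_shift']
      refine (((summable_exp_coarse' (d := d) hLc hδ z).mul_left Cv).mul_right (Zl (d + 1) δ)).congr fun u' => ?_
      rw [e]
  refine Summable.of_norm_bounded hMs (fun uw => ?_)
  rw [Real.norm_eq_abs, abs_mul]
  have h1 : |(if uw.2 β % (Lc : ℤ) = (Lc : ℤ) - 1 then (1 : ℝ) else 0)| ≤ 1 := by split_ifs <;> simp
  have h2 := hVF ν uw.1 z uw.2 (Sum.inl b) (Sum.inl β)
  rw [mul_add, Real.exp_add, ← mul_assoc] at h2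
  calc |(if uw.2 β % (Lc : ℤ) = (Lc : ℤ) - 1 then (1 : ℝ) else 0)| * |V ν uw.1 z uw.2 (Sum.inl b) (Sum.inl β)| ≤ 1 * M uw :=
        mul_le_mul h1 h2 (abs_nonneg _) zero_le_one
    _ = M uw := one_mul _

/-- [folklore] **PRODUCT-INDEXED = NESTED** for the right half-vertex: `Σ'_{(u′,w)} χ_β(w)·V_{ν,u′} z w (inl b)(inl β) = Σ'_{u′} Σ'_w χ_β(w)·V_{ν,u′} z w (inl b)(inl β)`. -/
theorem tsum_prod_rightHalfVertex (hLc : 1 ≤ Lc) (hr : r ∈ box (d + 1) Lc) {Cs δs : ℝ} (hS : LocStencil S Cs δs) (hδs : 0 < δs) (sf sm : ℝ) (j : ℕ)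
    (z : Site (d + 1)) (b : Fin (d + 1)) :
    ∑' uw : Site (d + 1) × Site (d + 1), (if uw.2 β % (Lc : ℤ) = (Lc : ℤ) - 1 then (1 : ℝ) else 0) *
        vertexOfK (unitK sf sm (coDressKBmAt (toSite r) Lc (KInvStep (d := d) Lc j))) Lc (unitS sf sm S) ν uw.1 z uw.2 (Sum.inl b) (Sum.inl β) =
      ∑' u' : Site (d + 1), ∑' w : Site (d + 1), (if w β % (Lc : ℤ) = (Lc : ℤ) - 1 then (1 : ℝ) else 0) *
        vertexOfK (unitK sf sm (coDressKBmAt (toSite r) Lc (KInvStep (d := d) Lc j))) Lc (unitS sf sm S) ν u' z w (Sum.inl b) (Sum.inl β) :=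
  (summable_prod_rightHalfVertex (ν := ν) (β := β) hLc hr hS hδs sf sm j z b).tsum_prod

end Decay

/-! ## §3 The literal word resummed over its second bond -/

section Slot

variable {Lc : ℕ} [NeZero Lc] {r : Fin (d + 1) → ℕ} {S : Fin (d + 1) → (Fin (d + 1) → ℤ) → MKer (d + 1) (Fib d)} {μ ν α β : Fin (d + 1)}

/-- [folklore] **THE INTEGRAND ON FIELD LEGS WITH THE LEG SUM OUTSIDE** (in-block root, `1 ≤ Lc`, level `j`, local `S` without field–multiplier blocks): for every second bond `u′`,
`Σ'_{(y,w)} χχ·((V_{μ,u} ∘ X̃♮_j) ∘ V_{ν,u′}) y w (inl α)(inl β) = Σ_b Σ'_{(y,w)} χχ·Σ'_z A_b(y,z)·V_{ν,u′} z w (inl b)(inl β)`,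
`A_b(y,z) = Σ'_{y₁} Σ_a V_{μ,u} y y₁ (inl α)(inl a)·X̃♮_j y₁ z (inl a)(inl b)` (twin of `ExchangeSlotLiteral.tsum_integrand_eq`). -/
theorem tsum_integrand_eq_of (hLc : 1 ≤ Lc) (hr : r ∈ box (d + 1) Lc) {Cs δs : ℝ} (hS : LocStencil S Cs δs) (hδs : 0 < δs)
    (hS01 : ∀ (κ : Fin (d + 1)) (v y z : Site (d + 1)) (a m : Fin (d + 1)), S κ v y z (Sum.inl a) (Sum.inr m) = 0)
    (hS10 : ∀ (κ : Fin (d + 1)) (v y z : Site (d + 1)) (m b : Fin (d + 1)), S κ v y z (Sum.inr m) (Sum.inl b) = 0)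
    (sf sm : ℝ) (j : ℕ) (u u' : Site (d + 1)) :
    (∑' yw : Site (d + 1) × Site (d + 1), (if yw.1 α % (Lc : ℤ) = (Lc : ℤ) - 1 then (1 : ℝ) else 0) * (if yw.2 β % (Lc : ℤ) = (Lc : ℤ) - 1 then (1 : ℝ) else 0) *
        comp (comp (vertexOfK (unitK sf sm (coDressKBmAt (toSite r) Lc (KInvStep (d := d) Lc j))) Lc (unitS sf sm S) μ u)
          (unitK sf sm (coDressKBmAt (toSite r) Lc (KInvStep (d := d) Lc j))))
          (vertexOfK (unitK sf sm (coDressKBmAt (toSite r) Lc (KInvStep (d := d) Lc j))) Lc (unitS sf sm S) ν u') yw.1 yw.2 (Sum.inl α) (Sum.inl β)) =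
      ∑ b : Fin (d + 1), ∑' yw : Site (d + 1) × Site (d + 1), (if yw.1 α % (Lc : ℤ) = (Lc : ℤ) - 1 then (1 : ℝ) else 0) * (if yw.2 β % (Lc : ℤ) = (Lc : ℤ) - 1 then (1 : ℝ) else 0) *
        ∑' z : Site (d + 1), (∑' y₁ : Site (d + 1), ∑ a : Fin (d + 1),
            vertexOfK (unitK sf sm (coDressKBmAt (toSite r) Lc (KInvStep (d := d) Lc j))) Lc (unitS sf sm S) μ u yw.1 y₁ (Sum.inl α) (Sum.inl a) *
              unitK sf sm (coDressKBmAt (toSite r) Lc (KInvStep (d := d) Lc j)) y₁ z (Sum.inl a) (Sum.inl b)) *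
          vertexOfK (unitK sf sm (coDressKBmAt (toSite r) Lc (KInvStep (d := d) Lc j))) Lc (unitS sf sm S) ν u' z yw.2 (Sum.inl b) (Sum.inl β) := by
  classical
  obtain ⟨δ, Cv, C2, CX, hδ, hCv, hC2, -, hVF, hVX, -⟩ := exists_decay_data_of hLc hr hS hδs sf sm j μ u
  have hAb : ∀ (b : Fin (d + 1)) (y z : Site (d + 1)), |(∑' y₁ : Site (d + 1), ∑ a : Fin (d + 1),
      vertexOfK (unitK sf sm (coDressKBmAt (toSite r) Lc (KInvStep (d := d) Lc j))) Lc (unitS sf sm S) μ u y y₁ (Sum.inl α) (Sum.inl a) *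
        unitK sf sm (coDressKBmAt (toSite r) Lc (KInvStep (d := d) Lc j)) y₁ z (Sum.inl a) (Sum.inl b))| ≤ C2 * Real.exp (-δ * (l1 (y - (Lc : ℤ) • u) + l1 (z - (Lc : ℤ) • u))) := by
    intro b y z
    have h := hVX y z (Sum.inl α) (Sum.inl b)
    simp only [comp, Fintype.sum_sum_type, vertexOfK_inl_inr_of_ff hS01, zero_mul, Finset.sum_const_zero, add_zero] at h
    exact h
  have hQb : ∀ (b : Fin (d + 1)) (u' z w : Site (d + 1)), |vertexOfK (unitK sf sm (coDressKBmAt (toSite r) Lc (KInvStep (d := d) Lc j))) Lc (unitS sf sm S) ν u' z w (Sum.inl b) (Sum.inl β)| ≤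
      Cv * Real.exp (-δ * (l1 (z - (Lc : ℤ) • u') + l1 (w - (Lc : ℤ) • u'))) := fun b u' z w => hVF ν u' z w (Sum.inl b) (Sum.inl β)
  have h₁ : ∀ y : Site (d + 1), |(if y α % (Lc : ℤ) = (Lc : ℤ) - 1 then (1 : ℝ) else 0)| ≤ 1 := fun y => by split_ifs <;> simp
  have h₂ : ∀ w : Site (d + 1), |(if w β % (Lc : ℤ) = (Lc : ℤ) - 1 then (1 : ℝ) else 0)| ≤ 1 := fun w => by split_ifs <;> simp
  have hyw : ∀ b : Fin (d + 1), Summable fun yw : Site (d + 1) × Site (d + 1) => (if yw.1 α % (Lc : ℤ) = (Lc : ℤ) - 1 then (1 : ℝ) else 0) * (if yw.2 β % (Lc : ℤ) = (Lc : ℤ) - 1 then (1 : ℝ) else 0) *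
      ∑' z : Site (d + 1), (∑' y₁ : Site (d + 1), ∑ a : Fin (d + 1),
          vertexOfK (unitK sf sm (coDressKBmAt (toSite r) Lc (KInvStep (d := d) Lc j))) Lc (unitS sf sm S) μ u yw.1 y₁ (Sum.inl α) (Sum.inl a) *
            unitK sf sm (coDressKBmAt (toSite r) Lc (KInvStep (d := d) Lc j)) y₁ z (Sum.inl a) (Sum.inl b)) *
        vertexOfK (unitK sf sm (coDressKBmAt (toSite r) Lc (KInvStep (d := d) Lc j))) Lc (unitS sf sm S) ν u' z yw.2 (Sum.inl b) (Sum.inl β) := by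
    intro b
    have hΦ := summable_slot_family (N := Lc) (A := fun y z => (∑' y₁ : Site (d + 1), ∑ a : Fin (d + 1),
          vertexOfK (unitK sf sm (coDressKBmAt (toSite r) Lc (KInvStep (d := d) Lc j))) Lc (unitS sf sm S) μ u y y₁ (Sum.inl α) (Sum.inl a) *
            unitK sf sm (coDressKBmAt (toSite r) Lc (KInvStep (d := d) Lc j)) y₁ z (Sum.inl a) (Sum.inl b)))
      (Q := fun u' z w => vertexOfK (unitK sf sm (coDressKBmAt (toSite r) Lc (KInvStep (d := d) Lc j))) Lc (unitS sf sm S) ν u' z w (Sum.inl b) (Sum.inl β))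
      hδ (hAb b) (hQb b) hC2 hCv h₁ h₂
    refine ((hΦ.prod_factor u').prod).congr fun yw => ?_
    show ∑' z : Site (d + 1), (if yw.1 α % (Lc : ℤ) = (Lc : ℤ) - 1 then (1 : ℝ) else 0) * (if yw.2 β % (Lc : ℤ) = (Lc : ℤ) - 1 then (1 : ℝ) else 0) *
        ((∑' y₁ : Site (d + 1), ∑ a : Fin (d + 1),
            vertexOfK (unitK sf sm (coDressKBmAt (toSite r) Lc (KInvStep (d := d) Lc j))) Lc (unitS sf sm S) μ u yw.1 y₁ (Sum.inl α) (Sum.inl a) *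
              unitK sf sm (coDressKBmAt (toSite r) Lc (KInvStep (d := d) Lc j)) y₁ z (Sum.inl a) (Sum.inl b)) *
          vertexOfK (unitK sf sm (coDressKBmAt (toSite r) Lc (KInvStep (d := d) Lc j))) Lc (unitS sf sm S) ν u' z yw.2 (Sum.inl b) (Sum.inl β)) = _
    rw [tsum_mul_left]
  rw [← Summable.tsum_finsetSum (fun b _ => hyw b)]
  refine tsum_congr fun yw => ?_
  rw [comp_comp_vertex_inl_inl_of_ff hS01 hS10, ← Finset.mul_sum]
  congr 1
  -- the `z`-sum of the finite leg sum is the finite leg sum of the `z`-sums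
  have hz : ∀ (b : Fin (d + 1)), Summable fun z : Site (d + 1) => (∑' y₁ : Site (d + 1), ∑ a : Fin (d + 1),
      vertexOfK (unitK sf sm (coDressKBmAt (toSite r) Lc (KInvStep (d := d) Lc j))) Lc (unitS sf sm S) μ u yw.1 y₁ (Sum.inl α) (Sum.inl a) *
        unitK sf sm (coDressKBmAt (toSite r) Lc (KInvStep (d := d) Lc j)) y₁ z (Sum.inl a) (Sum.inl b)) *
      vertexOfK (unitK sf sm (coDressKBmAt (toSite r) Lc (KInvStep (d := d) Lc j))) Lc (unitS sf sm S) ν u' z yw.2 (Sum.inl b) (Sum.inl β) := by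
    intro b
    refine Summable.of_norm_bounded ((((summable_exp_shift' hδ ((Lc : ℤ) • u)).mul_left (C2 * Real.exp (-δ * l1 (yw.1 - (Lc : ℤ) • u)))).mul_right Cv)) (fun z => ?_)
    rw [Real.norm_eq_abs, abs_mul]
    have hA' := hAb b yw.1 z
    rw [mul_add, Real.exp_add, ← mul_assoc] at hA'
    have hQ' : |vertexOfK (unitK sf sm (coDressKBmAt (toSite r) Lc (KInvStep (d := d) Lc j))) Lc (unitS sf sm S) ν u' z yw.2 (Sum.inl b) (Sum.inl β)| ≤ Cv :=
      (hQb b u' z yw.2).trans (mul_le_of_le_one_right hCv (Real.exp_le_one_iff.2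
        (by nlinarith [l1_nonneg (z - (Lc : ℤ) • u'), l1_nonneg (yw.2 - (Lc : ℤ) • u')])))
    exact mul_le_mul hA' hQ' (abs_nonneg _) (by positivity)
  rw [← Summable.tsum_finsetSum (fun b _ => hz b)]

set_option maxHeartbeats 400000 in
/-- [folklore] **THE LITERAL EE WORD RESUMMED OVER ITS SECOND BOND** (in-block root, `1 ≤ Lc`, level `j`, all units, any axes, local `S` without field–multiplier blocks, fixed first
bond `(μ, u)`): `HasSum (u′ ↦ Σ'_{(y,w)} χχ·((V_{μ,u} ∘ X̃♮_j) ∘ V_{ν,u′}) y w (inl α)(inl β)) (Σ_b Σ'_{(y,z)} χ_α(y)·A_b(y,z)·Σ'_{(u′,w)} χ_β(w)·V_{ν,u′} z w (inl b)(inl β))`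
(twin of `ExchangeSlotLiteral.hasSum_literal_slot`). -/
theorem hasSum_literal_slot_of (hLc : 1 ≤ Lc) (hr : r ∈ box (d + 1) Lc) {Cs δs : ℝ} (hS : LocStencil S Cs δs) (hδs : 0 < δs)
    (hS01 : ∀ (κ : Fin (d + 1)) (v y z : Site (d + 1)) (a m : Fin (d + 1)), S κ v y z (Sum.inl a) (Sum.inr m) = 0)
    (hS10 : ∀ (κ : Fin (d + 1)) (v y z : Site (d + 1)) (m b : Fin (d + 1)), S κ v y z (Sum.inr m) (Sum.inl b) = 0)
    (sf sm : ℝ) (j : ℕ) (u : Site (d + 1)) :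
    HasSum (fun u' : Site (d + 1) => ∑' yw : Site (d + 1) × Site (d + 1), (if yw.1 α % (Lc : ℤ) = (Lc : ℤ) - 1 then (1 : ℝ) else 0) * (if yw.2 β % (Lc : ℤ) = (Lc : ℤ) - 1 then (1 : ℝ) else 0) *
        comp (comp (vertexOfK (unitK sf sm (coDressKBmAt (toSite r) Lc (KInvStep (d := d) Lc j))) Lc (unitS sf sm S) μ u)
          (unitK sf sm (coDressKBmAt (toSite r) Lc (KInvStep (d := d) Lc j))))
          (vertexOfK (unitK sf sm (coDressKBmAt (toSite r) Lc (KInvStep (d := d) Lc j))) Lc (unitS sf sm S) ν u') yw.1 yw.2 (Sum.inl α) (Sum.inl β))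
      (∑ b : Fin (d + 1), ∑' yz : Site (d + 1) × Site (d + 1), (if yz.1 α % (Lc : ℤ) = (Lc : ℤ) - 1 then (1 : ℝ) else 0) *
        (∑' y₁ : Site (d + 1), ∑ a : Fin (d + 1), vertexOfK (unitK sf sm (coDressKBmAt (toSite r) Lc (KInvStep (d := d) Lc j))) Lc (unitS sf sm S) μ u yz.1 y₁ (Sum.inl α) (Sum.inl a) *
            unitK sf sm (coDressKBmAt (toSite r) Lc (KInvStep (d := d) Lc j)) y₁ yz.2 (Sum.inl a) (Sum.inl b)) *
        ∑' uw : Site (d + 1) × Site (d + 1), (if uw.2 β % (Lc : ℤ) = (Lc : ℤ) - 1 then (1 : ℝ) else 0) *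
          vertexOfK (unitK sf sm (coDressKBmAt (toSite r) Lc (KInvStep (d := d) Lc j))) Lc (unitS sf sm S) ν uw.1 yz.2 uw.2 (Sum.inl b) (Sum.inl β)) := by
  classical
  obtain ⟨δ, Cv, C2, CX, hδ, hCv, hC2, -, hVF, hVX, -⟩ := exists_decay_data_of hLc hr hS hδs sf sm j μ u
  have hAb : ∀ (b : Fin (d + 1)) (y z : Site (d + 1)), |(∑' y₁ : Site (d + 1), ∑ a : Fin (d + 1),
      vertexOfK (unitK sf sm (coDressKBmAt (toSite r) Lc (KInvStep (d := d) Lc j))) Lc (unitS sf sm S) μ u y y₁ (Sum.inl α) (Sum.inl a) *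
        unitK sf sm (coDressKBmAt (toSite r) Lc (KInvStep (d := d) Lc j)) y₁ z (Sum.inl a) (Sum.inl b))| ≤ C2 * Real.exp (-δ * (l1 (y - (Lc : ℤ) • u) + l1 (z - (Lc : ℤ) • u))) := by
    intro b y z
    have h := hVX y z (Sum.inl α) (Sum.inl b)
    simp only [comp, Fintype.sum_sum_type, vertexOfK_inl_inr_of_ff hS01, zero_mul, Finset.sum_const_zero, add_zero] at h
    exact h
  have hQb : ∀ (b : Fin (d + 1)) (u' z w : Site (d + 1)), |vertexOfK (unitK sf sm (coDressKBmAt (toSite r) Lc (KInvStep (d := d) Lc j))) Lc (unitS sf sm S) ν u' z w (Sum.inl b) (Sum.inl β)| ≤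
      Cv * Real.exp (-δ * (l1 (z - (Lc : ℤ) • u') + l1 (w - (Lc : ℤ) • u'))) := fun b u' z w => hVF ν u' z w (Sum.inl b) (Sum.inl β)
  have h₁ : ∀ y : Site (d + 1), |(if y α % (Lc : ℤ) = (Lc : ℤ) - 1 then (1 : ℝ) else 0)| ≤ 1 := fun y => by split_ifs <;> simp
  have h₂ : ∀ w : Site (d + 1), |(if w β % (Lc : ℤ) = (Lc : ℤ) - 1 then (1 : ℝ) else 0)| ≤ 1 := fun w => by split_ifs <;> simp
  have hb : ∀ b : Fin (d + 1), HasSum (fun u' : Site (d + 1) => ∑' yw : Site (d + 1) × Site (d + 1), (if yw.1 α % (Lc : ℤ) = (Lc : ℤ) - 1 then (1 : ℝ) else 0) * (if yw.2 β % (Lc : ℤ) = (Lc : ℤ) - 1 then (1 : ℝ) else 0) *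
      ∑' z : Site (d + 1), (∑' y₁ : Site (d + 1), ∑ a : Fin (d + 1),
          vertexOfK (unitK sf sm (coDressKBmAt (toSite r) Lc (KInvStep (d := d) Lc j))) Lc (unitS sf sm S) μ u yw.1 y₁ (Sum.inl α) (Sum.inl a) *
            unitK sf sm (coDressKBmAt (toSite r) Lc (KInvStep (d := d) Lc j)) y₁ z (Sum.inl a) (Sum.inl b)) *
        vertexOfK (unitK sf sm (coDressKBmAt (toSite r) Lc (KInvStep (d := d) Lc j))) Lc (unitS sf sm S) ν u' z yw.2 (Sum.inl b) (Sum.inl β))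
      (∑' yz : Site (d + 1) × Site (d + 1), (if yz.1 α % (Lc : ℤ) = (Lc : ℤ) - 1 then (1 : ℝ) else 0) *
        (∑' y₁ : Site (d + 1), ∑ a : Fin (d + 1), vertexOfK (unitK sf sm (coDressKBmAt (toSite r) Lc (KInvStep (d := d) Lc j))) Lc (unitS sf sm S) μ u yz.1 y₁ (Sum.inl α) (Sum.inl a) *
            unitK sf sm (coDressKBmAt (toSite r) Lc (KInvStep (d := d) Lc j)) y₁ yz.2 (Sum.inl a) (Sum.inl b)) *
        ∑' uw : Site (d + 1) × Site (d + 1), (if uw.2 β % (Lc : ℤ) = (Lc : ℤ) - 1 then (1 : ℝ) else 0) *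
          vertexOfK (unitK sf sm (coDressKBmAt (toSite r) Lc (KInvStep (d := d) Lc j))) Lc (unitS sf sm S) ν uw.1 yz.2 uw.2 (Sum.inl b) (Sum.inl β)) :=
    fun b => hasSum_slot_resum (N := Lc) (A := fun y z => (∑' y₁ : Site (d + 1), ∑ a : Fin (d + 1),
          vertexOfK (unitK sf sm (coDressKBmAt (toSite r) Lc (KInvStep (d := d) Lc j))) Lc (unitS sf sm S) μ u y y₁ (Sum.inl α) (Sum.inl a) *
            unitK sf sm (coDressKBmAt (toSite r) Lc (KInvStep (d := d) Lc j)) y₁ z (Sum.inl a) (Sum.inl b)))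
      (Q := fun u' z w => vertexOfK (unitK sf sm (coDressKBmAt (toSite r) Lc (KInvStep (d := d) Lc j))) Lc (unitS sf sm S) ν u' z w (Sum.inl b) (Sum.inl β))
      hδ (hAb b) (hQb b) hC2 hCv h₁ h₂
  have hsum := hasSum_sum (s := (Finset.univ : Finset (Fin (d + 1)))) (fun b _ => hb b)
  have efun : (fun u' : Site (d + 1) => ∑' yw : Site (d + 1) × Site (d + 1), (if yw.1 α % (Lc : ℤ) = (Lc : ℤ) - 1 then (1 : ℝ) else 0) * (if yw.2 β % (Lc : ℤ) = (Lc : ℤ) - 1 then (1 : ℝ) else 0) *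
        comp (comp (vertexOfK (unitK sf sm (coDressKBmAt (toSite r) Lc (KInvStep (d := d) Lc j))) Lc (unitS sf sm S) μ u)
          (unitK sf sm (coDressKBmAt (toSite r) Lc (KInvStep (d := d) Lc j))))
          (vertexOfK (unitK sf sm (coDressKBmAt (toSite r) Lc (KInvStep (d := d) Lc j))) Lc (unitS sf sm S) ν u') yw.1 yw.2 (Sum.inl α) (Sum.inl β)) =
      fun u' => ∑ b ∈ (Finset.univ : Finset (Fin (d + 1))), ∑' yw : Site (d + 1) × Site (d + 1), (if yw.1 α % (Lc : ℤ) = (Lc : ℤ) - 1 then (1 : ℝ) else 0) * (if yw.2 β % (Lc : ℤ) = (Lc : ℤ) - 1 then (1 : ℝ) else 0) *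
        ∑' z : Site (d + 1), (∑' y₁ : Site (d + 1), ∑ a : Fin (d + 1),
            vertexOfK (unitK sf sm (coDressKBmAt (toSite r) Lc (KInvStep (d := d) Lc j))) Lc (unitS sf sm S) μ u yw.1 y₁ (Sum.inl α) (Sum.inl a) *
              unitK sf sm (coDressKBmAt (toSite r) Lc (KInvStep (d := d) Lc j)) y₁ z (Sum.inl a) (Sum.inl b)) *
          vertexOfK (unitK sf sm (coDressKBmAt (toSite r) Lc (KInvStep (d := d) Lc j))) Lc (unitS sf sm S) ν u' z yw.2 (Sum.inl b) (Sum.inl β) :=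
    funext fun u' => tsum_integrand_eq_of (μ := μ) (ν := ν) (α := α) (β := β) hLc hr hS hδs hS01 hS10 sf sm j u u'
  rw [efun]
  exact hsum

end Slot

end Summit.QuantumFields.BalabanUV.Beta.GAN24.ExchangeLatticeWordSlot

end
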